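import Literature.AlgebraicGeometry.Resolution.PlaneChartColength
import HarnessLib

/-!
# The weak transform of a two-generated ideal of `κ⟦x, y⟧` has colength `< dim R/J − dim R/𝔪ʳ`

`Literature/AlgebraicGeometry/Resolution/PlaneChartColengthDrop.lean`, continuing
`PlaneChartColength.lean` (same namespace). With `Θ` the chart endomorphism `X i ↦ X i`,
`X j ↦ X i (X j + t)` of `R = κ⟦X₀, X₁⟧` and `J^c = J B ∩ R` the contraction of `J` from the chart
algebra `B`:

* `colon_eq_of_contracted` — a contracted ideal is `𝔪`-full: `J^c = J ⇒ (𝔪J : X i) = J`;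
* `finrank_quotient_pow_succ_sup_span_le_of_colon_eq` — for an `𝔪`-full `J ≤ 𝔪ʳ` spanned by a finite
  set `S` in a local `κ`-algebra with residue field `κ`: `dim_κ A/(𝔪ʳ⁺¹ + (x)) ≤ |S|`
  (Huneke–Swanson §14.1: the minimal number of generators of an `𝔪`-full ideal is `≥ μ(𝔪ʳ) = r + 1`);
* `succ_le_finrank_quotient_pow_succ_sup_span` — `dim_κ R/(𝔪ʳ⁺¹ + (X i)) ≥ r + 1`;
* `finrank_quotient_weakTransform_add_lt` — **for `J = (g₁, g₂) ≤ 𝔪ʳ`, `r ≥ 2`, of finite colength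
  with some `f ∈ J`, `f ∉ (X i) + 𝔪ʳ⁺¹`, and `Θ(J)R = (X i)ʳ J'`:
  `dim_κ R/J' + dim_κ R/𝔪ʳ < dim_κ R/J`** (a two-generated `𝔪`-primary ideal of order `≥ 2` is
  never contracted, so `J ⊊ J^c`, and `dim R/J' + dim R/𝔪ʳ ≤ dim R/J^c` by Huneke–Swanson 14.3.4).

This is the colength engine of the one-blow-up Milnor-number drop for the gradient ideal of a plane
formal function (crux `ClassicalRegimes` of summit `ResolutionOfSingularities`). Everything is PROVED;
no definitions.

## References
* [HunekeSwanson2006] C. Huneke, I. Swanson, Integral Closure of Ideals, Rings, and Modules, CUP 2006,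
  Lemma 14.3.4, Prop. 14.1.7, §14.1.
-/

noncomputable section

open MvPowerSeries IsLocalRing Finsupp Module
open Literature.RingTheory.MvPowerSeries.Jets Literature.RingTheory.Length

namespace Literature.AlgebraicGeometry.Resolution.PlaneChart

universe u

variable {κ : Type u} [Field κ]

/-! ### `𝔪`-fullness and the number of generators (Huneke–Swanson §14.1) -/

section Full

variable {i j : Fin 2} (hij : j ≠ i) (t : κ)
  (Θ : MvPowerSeries (Fin 2) κ →ₐ[κ] MvPowerSeries (Fin 2) κ)
  (hΘi : Θ (X i) = X i) (hΘj : Θ (X j) = X i * (X j + C t))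
  (B : Subalgebra κ (MvPowerSeries (Fin 2) κ))
  (hB : ∀ s, s ∈ B ↔ ∃ (n : ℕ) (b : MvPowerSeries (Fin 2) κ),
    b ∈ maximalIdeal (MvPowerSeries (Fin 2) κ) ^ n ∧ Θ b = X i ^ n * s)
  [Algebra (MvPowerSeries (Fin 2) κ) B]
  (halg : ∀ b, ((algebraMap (MvPowerSeries (Fin 2) κ) B b : B) : MvPowerSeries (Fin 2) κ) = Θ b)

include hij hΘi hΘj hB halg in
/-- **A contracted ideal is `𝔪`-full**: if `J B ∩ R = J` then `(𝔪 J : x) = J` (`x g ∈ 𝔪 J` gives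
`Θ g ∈ (𝔪J)B / x = J B`). [cite: HunekeSwanson2006, Prop. 14.1.7] -/
theorem colon_eq_of_contracted {J : Ideal (MvPowerSeries (Fin 2) κ)}
    (hC : (J.map (algebraMap (MvPowerSeries (Fin 2) κ) B)).comap (algebraMap (MvPowerSeries (Fin 2) κ) B) = J) :
    (maximalIdeal (MvPowerSeries (Fin 2) κ) * J).colon {(X i : MvPowerSeries (Fin 2) κ)} = J := by
  let φ : MvPowerSeries (Fin 2) κ →+* B := algebraMap (MvPowerSeries (Fin 2) κ) B
  have hmS : (maximalIdeal _).map φ = Ideal.span {φ (X i)} := map_maximalIdeal_chart hij t Θ hΘi hΘj B hB halg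
  have hxS : φ (X i) ∈ nonZeroDivisors B := algebraMap_X_mem_nonZeroDivisors Θ hΘi B halg
  apply le_antisymm
  · intro g hg
    rw [Submodule.mem_colon_singleton, smul_eq_mul] at hg
    have h1 : φ (g * X i) ∈ (maximalIdeal _ * J).map φ := Ideal.mem_map_of_mem _ hg
    rw [Ideal.map_mul, hmS, map_mul, mul_comm (φ g), Ideal.mem_span_singleton_mul] at h1
    obtain ⟨s, hs, hseq⟩ := h1
    have hgs : φ g = s := by
      have := (mul_cancel_left_mem_nonZeroDivisors hxS).mp hseq
      exact this.symm
    rw [← hC, Ideal.mem_comap]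
    change φ g ∈ J.map φ
    rw [hgs]; exact hs
  · intro g hg
    rw [Submodule.mem_colon_singleton, smul_eq_mul, mul_comm g (X i)]
    exact Ideal.mul_mem_mul (X_mem_maximalIdeal κ (Fin 2) i) hg

end Full

/-- **An `𝔪`-full ideal generated by `k` elements forces `dim_κ A/(𝔪ʳ⁺¹ + (x)) ≤ k`.** Let `A` be a
local `κ`-algebra with residue field `κ` (every element is a constant modulo `𝔪`), `x ∈ 𝔪`, and
`J ≤ 𝔪ʳ` an ideal spanned by a finite set `S` with `(𝔪J : x) = J` and `A ⧸ 𝔪J` finite over `κ`. Then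
`dim_κ A/(𝔪ʳ⁺¹ + (x)) ≤ |S|`: indeed `dim A/𝔪J = dim A/J + dim A/(𝔪J + (x))` by the colon sequence,
`dim A/𝔪J ≤ dim A/J + |S|` since `J/𝔪J` is spanned over `κ` by `S`, and `𝔪J + (x) ≤ 𝔪ʳ⁺¹ + (x)`
(Huneke–Swanson §14.1: `μ(J) ≥ μ(𝔪ʳ)` for `𝔪`-full `J`). [cite: HunekeSwanson2006, §14.1] -/
theorem finrank_quotient_pow_succ_sup_span_le_of_colon_eq {A : Type*} [CommRing A] [Algebra κ A]
    [IsLocalRing A] (hres : ∀ a : A, ∃ c : κ, a - algebraMap κ A c ∈ maximalIdeal A)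
    {x : A} {J : Ideal A} {r : ℕ} (hJ : J ≤ maximalIdeal A ^ r) (S : Finset A)
    (hS : J = Ideal.span (S : Set A)) (hfull : (maximalIdeal A * J).colon {x} = J)
    [Module.Finite κ (A ⧸ maximalIdeal A * J)] :
    finrank κ (A ⧸ (maximalIdeal A ^ (r + 1) ⊔ Ideal.span {x})) ≤ S.card := by
  classical
  set 𝔪 := maximalIdeal A with h𝔪
  have hmJ_le : 𝔪 * J ≤ J := Ideal.mul_le_left
  -- colon sequence: `dim A/𝔪J = dim A/J + dim A/(𝔪J + (x))`
  have hcol := finrank_quotient_eq_colon_add (κ := κ) (𝔪 * J) x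
  rw [hfull] at hcol
  -- third isomorphism: `dim A/𝔪J = dim A/J + dim J/𝔪J`
  have hthird := finrank_quotient_add_finrank_map (κ := κ) hmJ_le
  -- `J/𝔪J` is spanned over `κ` by the images of `S`
  have hspan : (Submodule.map (Submodule.mkQ (𝔪 * J)) J).restrictScalars κ ≤
      Submodule.span κ ((fun s => Submodule.mkQ (𝔪 * J) s) '' (S : Set A)) := by
    rintro _ ⟨g, hg, rfl⟩
    rw [hS] at hg
    refine Submodule.span_induction (p := fun g _ => Submodule.mkQ (𝔪 * J) g ∈
        Submodule.span κ ((fun s => Submodule.mkQ (𝔪 * J) s) '' (S : Set A))) ?_ ?_ ?_ ?_ hg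
    · intro s hs; exact Submodule.subset_span ⟨s, hs, rfl⟩
    · simp
    · intro a b _ _ ha hb; rw [map_add]; exact Submodule.add_mem _ ha hb
    · intro a g hg' hga
      obtain ⟨c, hc⟩ := hres a
      have hsplit : a • g = c • g + (a - algebraMap κ A c) * g := by
        rw [smul_eq_mul, Algebra.smul_def]; ring
      rw [hsplit, map_add, LinearMap.map_smul_of_tower]
      refine Submodule.add_mem _ (Submodule.smul_mem _ _ hga) ?_
      have : (a - algebraMap κ A c) * g ∈ 𝔪 * J := Ideal.mul_mem_mul hc (by rw [hS]; exact hg')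
      rw [Submodule.mkQ_apply, (Submodule.Quotient.mk_eq_zero _).mpr this]
      exact Submodule.zero_mem _
  have hcard : finrank κ (Submodule.map (Submodule.mkQ (𝔪 * J)) J) ≤ S.card := by
    have h1 : finrank κ ((Submodule.map (Submodule.mkQ (𝔪 * J)) J).restrictScalars κ) ≤
        finrank κ (Submodule.span κ ((fun s => Submodule.mkQ (𝔪 * J) s) '' (S : Set A))) :=
      Submodule.finrank_mono hspan
    have h2 : finrank κ (Submodule.span κ ((fun s => Submodule.mkQ (𝔪 * J) s) '' (S : Set A))) ≤ S.card := by
      rw [← Finset.coe_image]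
      exact (finrank_span_finset_le_card _).trans Finset.card_image_le
    exact h1.trans h2
  -- `𝔪J + (x) ≤ 𝔪ʳ⁺¹ + (x)`
  have hle : 𝔪 * J ⊔ Ideal.span {x} ≤ 𝔪 ^ (r + 1) ⊔ Ideal.span {x} := by
    refine sup_le_sup_right ?_ _
    rw [pow_succ']
    exact Ideal.mul_mono_right hJ
  haveI : Module.Finite κ (A ⧸ 𝔪 * J ⊔ Ideal.span {x}) := finite_quotient_of_le (κ := κ) le_sup_left
  have hmono := finrank_quotient_le_of_le (κ := κ) hle
  omega

/-- **`dim_κ κ⟦X₀,X₁⟧/(𝔪ʳ⁺¹ + (X i)) ≥ r + 1`**: the classes of `1, X j, …, X jʳ` are linearly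
independent. [folklore] -/
theorem succ_le_finrank_quotient_pow_succ_sup_span {i j : Fin 2} (hij : j ≠ i) (r : ℕ) :
    r + 1 ≤ finrank κ (MvPowerSeries (Fin 2) κ ⧸
      (maximalIdeal (MvPowerSeries (Fin 2) κ) ^ (r + 1) ⊔ Ideal.span {(X i : MvPowerSeries (Fin 2) κ)})) := by
  classical
  set L : Ideal (MvPowerSeries (Fin 2) κ) :=
    maximalIdeal (MvPowerSeries (Fin 2) κ) ^ (r + 1) ⊔ Ideal.span {(X i : MvPowerSeries (Fin 2) κ)} with hL
  haveI : Module.Finite κ (MvPowerSeries (Fin 2) κ ⧸ L) := finite_quotient_of_pow_le (le_sup_left)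
  -- the family `k ↦ X j ^ k` (`k ≤ r`) is linearly independent modulo `L`
  have hli : LinearIndependent κ (fun k : Fin (r + 1) =>
      Ideal.Quotient.mk L ((X j : MvPowerSeries (Fin 2) κ) ^ (k : ℕ))) := by
    rw [Fintype.linearIndependent_iff]
    intro c hc k
    have hsum : (Ideal.Quotient.mk L) (∑ l : Fin (r + 1), C (c l) * (X j : MvPowerSeries (Fin 2) κ) ^ (l : ℕ)) = 0 := by
      rw [map_sum]
      rw [← hc]
      refine Finset.sum_congr rfl fun l _ => ?_
      rw [map_mul, Algebra.smul_def, ← Ideal.Quotient.mk_algebraMap, MvPowerSeries.algebraMap_apply,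
        Algebra.algebraMap_self, RingHom.id_apply]
    rw [Ideal.Quotient.eq_zero_iff_mem, hL, Submodule.mem_sup] at hsum
    obtain ⟨a, ha, b, hb, hab⟩ := hsum
    obtain ⟨q, rfl⟩ := Ideal.mem_span_singleton'.mp hb
    -- compare the coefficient of `X j ^ k`
    have hk : (k : ℕ) < r + 1 := k.2
    have key := congrArg (coeff (single j (k : ℕ))) hab
    rw [map_add, coeff_eq_zero_of_mem_maximalIdeal_pow ha (by rw [degree_single]; exact hk), zero_add,
      map_sum] at key
    have hq : coeff (single j (k : ℕ)) (q * X i) = 0 := by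
      rw [mul_comm]
      exact (MvPowerSeries.X_dvd_iff.mp (dvd_mul_right _ _)) _ (by simp [hij])
    rw [hq] at key
    have hterm : ∀ l : Fin (r + 1), coeff (single j (k : ℕ)) (C (c l) * (X j : MvPowerSeries (Fin 2) κ) ^ (l : ℕ)) =
        if l = k then c k else 0 := by
      intro l
      rw [X_pow_eq, ← MvPowerSeries.monomial_zero_eq_C_apply, monomial_mul_monomial, zero_add, mul_one,
        coeff_monomial]
      by_cases hlk : l = k
      · subst hlk; simp
      · rw [if_neg, if_neg hlk]
        intro h
        exact hlk (Fin.ext (single_injective j h).symm)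
    simp_rw [hterm] at key
    rw [Finset.sum_ite_eq' Finset.univ k, if_pos (Finset.mem_univ _)] at key
    exact key.symm
  simpa using hli.fintype_card_le_finrank


/-! ### The strict drop for two-generated ideals -/

/-- **Colength drop of the weak transform for a two-generated ideal.** Let `Θ` be the chart
endomorphism `X i ↦ X i`, `X j ↦ X i (X j + t)` of `R = κ⟦X₀, X₁⟧`, `J = (g₁, g₂) ≤ 𝔪ʳ` with
`r ≥ 2` an ideal of finite colength containing some `f ∉ (X i) + 𝔪ʳ⁺¹`, and `J'` of finite colength
with `Θ(J) R = (X i)ʳ J'` (the weak transform at the point `t`). Then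
`dim_κ R/J' + dim_κ R/𝔪ʳ < dim_κ R/J`.
Indeed `dim R/J' + dim R/𝔪ʳ ≤ dim R/J^c` (Huneke–Swanson 14.3.4) and `J ⊊ J^c`: a contracted `J`
would be `𝔪`-full, forcing `r + 1 ≤ dim R/(𝔪ʳ⁺¹ + (X i)) ≤ 2`.
[cite: HunekeSwanson2006, Lemma 14.3.4 and §14.1] -/
theorem finrank_quotient_weakTransform_add_lt {i j : Fin 2} (hij : j ≠ i) (t : κ)
    (Θ : MvPowerSeries (Fin 2) κ →ₐ[κ] MvPowerSeries (Fin 2) κ)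
    (hΘi : Θ (X i) = X i) (hΘj : Θ (X j) = X i * (X j + C t))
    {r : ℕ} (hr : 2 ≤ r)
    {J : Ideal (MvPowerSeries (Fin 2) κ)} (hJ : J ≤ maximalIdeal (MvPowerSeries (Fin 2) κ) ^ r)
    {f : MvPowerSeries (Fin 2) κ} (hfJ : f ∈ J)
    (hf : f ∉ Ideal.span {(X i : MvPowerSeries (Fin 2) κ)} ⊔ maximalIdeal (MvPowerSeries (Fin 2) κ) ^ (r + 1))
    (g₁ g₂ : MvPowerSeries (Fin 2) κ) (hJgen : J = Ideal.span {g₁, g₂})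
    [Module.Finite κ (MvPowerSeries (Fin 2) κ ⧸ J)]
    {J' : Ideal (MvPowerSeries (Fin 2) κ)}
    (hJ' : J.map (Θ : MvPowerSeries (Fin 2) κ →+* MvPowerSeries (Fin 2) κ) =
      Ideal.span {(X i : MvPowerSeries (Fin 2) κ) ^ r} * J')
    [Module.Finite κ (MvPowerSeries (Fin 2) κ ⧸ J')] :
    finrank κ (MvPowerSeries (Fin 2) κ ⧸ J') +
        finrank κ (MvPowerSeries (Fin 2) κ ⧸ maximalIdeal (MvPowerSeries (Fin 2) κ) ^ r) <
      finrank κ (MvPowerSeries (Fin 2) κ ⧸ J) := by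
  classical
  -- the chart algebra
  obtain ⟨B, hB⟩ := exists_chartSubalgebra Θ hΘi
  have hΘB : ∀ b, Θ b ∈ B := fun b => (hB _).mpr ⟨0, b, by simp, by simp⟩
  letI : Algebra (MvPowerSeries (Fin 2) κ) B :=
    ((Θ : MvPowerSeries (Fin 2) κ →+* MvPowerSeries (Fin 2) κ).codRestrict B hΘB).toAlgebra
  have halg : ∀ b, ((algebraMap (MvPowerSeries (Fin 2) κ) B b : B) : MvPowerSeries (Fin 2) κ) = Θ b :=
    fun b => rfl
  have hBsurj : ∀ J₁ : Ideal (MvPowerSeries (Fin 2) κ), Module.Finite κ (MvPowerSeries (Fin 2) κ ⧸ J₁) →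
      Function.Surjective fun b : B => Ideal.Quotient.mk J₁ (b : MvPowerSeries (Fin 2) κ) := by
    intro J₁ hfin
    refine mk_comp_subtype_surjective_of_finite_quotient J₁ B fun l => ?_
    have hl : l = i ∨ l = j := by fin_cases i <;> fin_cases j <;> fin_cases l <;> simp_all
    rcases hl with rfl | rfl
    · exact X_self_mem_chart Θ hΘi B hB
    · exact X_other_mem_chart t Θ hΘi hΘj B hB
  -- Huneke–Swanson
  have hle := finrank_quotient_weakTransform_add_le hij t Θ hΘi hΘj B hB halg hBsurj (by omega) hJ hfJ hf hJ'
  by_cases hC : (J.map (algebraMap (MvPowerSeries (Fin 2) κ) B)).comap (algebraMap (MvPowerSeries (Fin 2) κ) B) = J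
  · -- a contracted two-generated ideal of order `≥ 2` is impossible
    exfalso
    have hfull := colon_eq_of_contracted hij t Θ hΘi hΘj B hB halg hC
    obtain ⟨N, hN⟩ := exists_maximalIdeal_pow_le_of_finite_quotient J
    haveI : Module.Finite κ (MvPowerSeries (Fin 2) κ ⧸ maximalIdeal (MvPowerSeries (Fin 2) κ) * J) :=
      finite_quotient_of_pow_le (N := N + 1) (by rw [pow_succ']; exact Ideal.mul_mono_right hN)
    have hres : ∀ a : MvPowerSeries (Fin 2) κ, ∃ c : κ,
        a - algebraMap κ (MvPowerSeries (Fin 2) κ) c ∈ maximalIdeal (MvPowerSeries (Fin 2) κ) := fun a =>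
      ⟨constantCoeff a, by
        rw [mem_maximalIdeal_iff_constantCoeff_eq_zero, map_sub, ← MvPowerSeries.c_eq_algebraMap,
          constantCoeff_C, sub_self]⟩
    have h2 := finrank_quotient_pow_succ_sup_span_le_of_colon_eq (κ := κ) hres
      (x := (X i : MvPowerSeries (Fin 2) κ)) hJ ({g₁, g₂} : Finset (MvPowerSeries (Fin 2) κ))
      (by rw [hJgen, Finset.coe_insert, Finset.coe_singleton]) hfull
    have h3 := succ_le_finrank_quotient_pow_succ_sup_span (κ := κ) hij r
    have hcard : ({g₁, g₂} : Finset (MvPowerSeries (Fin 2) κ)).card ≤ 2 := Finset.card_le_two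
    omega
  · have hlt : J < (J.map (algebraMap (MvPowerSeries (Fin 2) κ) B)).comap (algebraMap (MvPowerSeries (Fin 2) κ) B) :=
      lt_of_le_of_ne Ideal.le_comap_map (Ne.symm hC)
    have := finrank_quotient_lt_of_lt (κ := κ) hlt
    omega

end Literature.AlgebraicGeometry.Resolution.PlaneChart

end
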